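import Literature.MathematicalPhysics.QuantumFieldTheory.Balaban1983to89.B9Thm310Whole
import Literature.MathematicalPhysics.QuantumFieldTheory.Balaban1983to89.B9Ineq347AllEntries

/-!
# `Balaban1983to89.B9RWSums343to347Whole` — [B9] «the expansion is convergent in all norms appearing in the inequalities
# (3.42)–(3.47)» (Thm 3.7 p. 409 ∕ Thm 3.10 p. 416) AS THE SUMMATION LEAF `B9.RWSumsYieldIneqs` at ALL-BLOCKS pins of the two
# expansion data: the (3.42) and (3.47) blocks of the sums PROVED from the sup majorants, the Hölder ∕ L² blocks (3.43)–(3.46)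
# carried inside the pinned convergence predicate under the leaves' provisos

T. Bałaban, *Propagators for lattice gauge theories in a background field*, Commun. Math. Phys. **99** (1985) 389–434
[`Balaban1985BackgroundPropagators`, "B9"]; [4] = T. Bałaban, *Propagators and renormalization transformations for lattice
gauge theories. II*, Commun. Math. Phys. **96** (1984) 223–250 [`Balaban1984PropagatorsII`].

statement-level skeleton of published theorems with citation tags; proofs where landed; nothing here is a claim about the
Yang–Mills mass gap

THE PRINTED LOCI (verbatim).  p. 409, Theorem 3.7: *"The expansion is convergent in all norms appearing in the inequalities
(3.42)–(3.47)."*; p. 410: *"Theorem 3.7 implies that all the inequalities (3.42)–(3.47) hold for G′, thus we have completed the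
proof of Theorem 3.1."*; p. 416, Theorem 3.10: *"… satisfies the inequality (3.108) and the corresponding inequalities for norms
on the left-hand sides of (3.42)–(3.47). The constant O(1) depends on d and L only. From (3.108) it follows that the expansion
(3.107) is convergent in all norms in the inequalities (3.42)–(3.47). This implies Theorem 3.3."*; p. 398 (after Theorem 3.1):
*"Next, the choice of powers L^jη is conventional also. Using Lemma 2.1 in [4] we may replace the factor (L^jη)^α by
(L^jη)^β(L^{j′}η)^γ with β + γ = α, j, j′ are indices of localizations. It is easy to see that the global inequalities (3.47)
are consequences of the local ones (3.42) and Lemma 2.1."*; (3.47): *"|G′(U)λ|_{(2+γ)}, |∇_UG′(U)λ|_{(1+γ)}, |G′(U)∇\*_Uλ|_{(1+γ)},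
|Δ_UG′(U)λ|_{(γ)} ≦ B₀|λ|_{(γ)} for γ in a fixed compact subset of real numbers, e.g. for γ ∈ [−4, 4]"*; (3.41): *"|A|_{(α)} =
sup_j sup_{b∈Ω_j∖Ω_{j+1}} (L^jη)^{−α}|A(b)|. Thus the norm |A|_{(α)} can be defined as the smallest number C such, that |A(b)| ≦
C(L^jη)^α for b ∈ Ω_j∖Ω_{j+1}"*.

THE POINT (seat `pub-ymgap-dag-n06-d` INTERFACE-2∕2b on the pub-ymgap bus, 2026-08-26).  The cell's typed summation leaf
`B9.RWSumsYieldIneqs geo bg E7 E10 Gp GA` (B9.lean) is PROVISO-FREE: «∃ B₀ δ₀ B₀(·) B′₀(·) B′₀(·,·), ∀ i U,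
((E7 i).Converges U → Ineq342_346_347 (Gp i) ∧ Ineq343_345 (Gp i)) ∧ ((E10 i).Converges U → … (GA i) …)».  Hence whatever it
yields must be ENTAILED by the pinned convergence predicates — a pin carrying only the four sup majorants (n06-c's `Conv342` at
`E37OfOps` ∕ `W38OfOps`, this seat's `Conv3107` at `W310OfOps … (Conv3107 …)`) cannot serve the Hölder members with family-uniform
constants.  THIS FILE types the ALL-BLOCKS pins and moves the content where print has it — inside Theorem 3.7 ∕ 3.10 under
their provisos:

* §1 `GlobReads` — the co-reading of the weighted quantities (3.47) of a kernel family by a model operator (the (3.41) weight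
  (L^jη)^γ: |λ(x)| ≦ (L^{j′}η)^γ|λ|_{(γ)} on Δ(y′), and |Tλ|_{(p+γ)} is the smallest constant in |(Tλ)(v)| ≦ c(L^jη)^{p+γ});
  `Facts347` — the member facts of [4] Lemma 2.1 the printed derivation of (3.47) uses ((2.60), (2.61), L ≧ 1, η > 0, the located
  size condition 4·log L ≦ αδRM of `B9Ineq347AllEntries`); `glob_of_majorant` — **(3.47)_n ⇐ (3.42)_n** for a co-read kernel
  family, by `B9Ineq347AllEntries.glob347_of_342_weighted_rpow`, constant C·c₁(1 − α)·L₀⁴ on γ ∈ [−4, 4].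
* §2 `allIneqs_of_majorants` — ONE member, ONE U: from the four sup majorants of the model operators (the content of `Conv342` ∕
  `Conv3107`), the co-readings `B9Thm37GlueCor36.CoRealizes` (n06-c) and `GlobReads`, the member facts, and the DISPLAYED blocks
  (3.43)–(3.45) (`B9.Ineq343_345 K …`) and (3.46) (the six L² lines) — the typed conclusion of Theorems 3.1 ∕ 3.3 for the kernel
  family K at U: `B9.Ineq342_346_347 K B₀ δ₀ U ∧ B9.Ineq343_345 K Bβ Bε Bεβ δ₀ U`.
* §3 the all-blocks pins `ConvAll342 𝔬 …` ∕ `ConvAll3107 𝔬 …` (sup majorants ∧ the typed blocks for the kernel family READ FROM the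
  sum) and the data `E37AllOfOps 𝔴 𝔬 …` (n06-c's `E37OfOps` with the strengthened predicate; Corollary 3.8 untouched, `Iff.rfl`)
  ∕ `W310OfOps 𝔬 rd (ConvAll3107 …)`; `thm37Printed_strengthen` ∕ `thm310Printed_W310OfOps_strengthen` (a leaf whose convergence
  predicate is implied under provisos by another leaf's predicate).
* §4 ★ `thm37Printed_allPin` ∕ ★ `thm310Printed_allPin` — the leaves `B9.Thm37Printed` ∕ `B9.Thm310Printed` AT THE ALL-BLOCKS
  PINS from the leaves at the sup-block pins (n06-c's `thm37Printed_of_local342`, this seat's `thm310Printed_of_local3107`), the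
  co-readings, the member facts for M ≧ M_g, and the displayed Hölder ∕ L² blocks under provisos.
* §5 ★ `rwSumsYieldIneqs_allPins` — **THE SUMMATION LEAF** `B9.RWSumsYieldIneqs geo bg (E37AllOfOps …) (W310OfOps … (ConvAll3107 …))
  Gp GA` — two projections; with `B9.thm31_of_thm37` ∕ `B9.thm33_of_thm37_310` the cell's bookkeeping to Theorems 3.1 ∕ 3.3.

HONEST SCOPE.  Nothing of print is asserted.  PROVED here (kernel-checked bookkeeping over the lineage's objects): the (3.42)
clauses and the (3.47) lines of both sums from the sup majorants, under the readings and the member facts.  NOT PROVED, displayed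
as hypotheses of printed shape under the leaves' provisos: the Hölder members (3.43), (3.45) and the L² members (3.46) of the sums
(*"Similar estimates hold for the other norms"*, Cor. 3.8 p. 410; the tree's engines `B9Thm37AllNorms.thm37_left` ∕
`B9Thm37AllNormsRight` ∕ `B9SectDL2Decay.l2w` produce `B11SectG.HasMaj` majorants in arbitrary block norms, but no reading of them
into the `B9.KernelFamily` fields `h1` ∕ `l2` exists in the tree), and the input-side Hölder member (3.44) (an OPEN entry of the
cell for the random-walk sums, GAPS G-B9-02∕G-B9-07; at U′U it is r06's `B9Thm34HolderInputGp` ∕ `…G`).  The member facts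
(2.60)∕(2.61)∕size are hypotheses «for M ≧ M_g» ([4] Lemma 2.1, (2.59)).  Value: the summation leaf inhabited WITHOUT an
undischargeable proviso-free residual; NOT a node discharge, NOT summit progress; one finite lattice paper; nothing continuum,
nothing about the mass gap.  Cell `pub-ymgap` (HUMAN RULING D-0062), Track A node N06 [B9], seat `pub-ymgap-dag-n06-k`
(N06-ASSIGNMENT v1 row 19), 2026-08-26.
-/

namespace Literature.MathematicalPhysics.QuantumFieldTheory.Balaban1983to89.B9RWSums343to347Whole

open Literature.MathematicalPhysics.QuantumFieldTheory.Balaban1983to89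
open Finset B6RandomWalk B6RandomWalkHom B9Thm37Sum B9Thm34Ext B9Thm37Glue B9Thm37Whole B9Cor38Whole B9Thm310Whole
open B9Thm37GlueCor36 B9SectCDiffDict B9Ineq347AllEntries

noncomputable section

/-! ## §1 The (3.47) co-reading, the member facts of [4] Lemma 2.1, and (3.47)_n ⇐ (3.42)_n at one member -/

section Glob

variable {g : B9.Geometry} [Fintype g.Site] [DecidableEq g.Site] {R : ℝ} {H : Prop} {B : B9.Backgrounds}
variable {u v : Type}

/-- **CO-READING of the n-th weighted quantity (3.47) of a kernel family by a model operator** (companion of n06-c's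
`B9Thm37GlueCor36.CoRealizes` for the sup entries).  Print, (3.41) p. 397: *"|A|_{(α)} = sup_j sup_{b∈Ω_j∖Ω_{j+1}} (L^jη)^{−α}|A(b)|
… the norm |A|_{(α)} can be defined as the smallest number C such, that |A(b)| ≦ C(L^jη)^α for b ∈ Ω_j∖Ω_{j+1}"*; (3.47) p. 398:
the n-th left member is |Tλ|_{(p_n+γ)}, p = [2, 1, 1, 0], against |λ|_{(γ)}.  Typed: `ev λ` evaluates the abstract argument λ on
the model lattice `v`; |ev λ(x)| ≦ (L^{j(x)}η)^γ|λ|_{(γ)} pointwise (`wbound`; |λ|_{(γ)} = `g.wNorm γ λ` ≧ 0, `wnorm_nonneg`); and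
glob_n(U, λ, γ) is BELOW every c ≧ 0 with |(T(ev λ))(x)| ≦ c(L^{j(x)}η)^{p_n+γ} for all x (`obs` — glob_n is that weighted sup).
OURS (typing): a hypothesis schema on how a model instantiates `B9.Geometry.wNorm` ∕ `B9.KernelFamily.glob`; nothing is asserted.
[cite: Balaban1985BackgroundPropagators, (3.41) p.397 + (3.47) p.398] -/
structure GlobReads (K : B9.KernelFamily g B) (n : Fin 4) (U : B.Cfg) (bu : u → g.Site) (bv : v → g.Site)
    (ev : g.Loc → v → ℝ) (T : (v → ℝ) →ₗ[ℝ] (u → ℝ)) : Prop where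
  wbound : ∀ (lam : g.Loc) (γ : ℝ) (x : v), |ev lam x| ≤ g.len (bv x) ^ γ * g.wNorm γ lam
  wnorm_nonneg : ∀ (lam : g.Loc) (γ : ℝ), 0 ≤ g.wNorm γ lam
  obs : ∀ (lam : g.Loc) (γ c : ℝ), 0 ≤ c →
    (∀ x : u, |T (ev lam) x| ≤ c * g.len (bu x) ^ ((![2, 1, 1, 0] : Fin 4 → ℝ) n + γ)) → K.glob n U lam γ ≤ c

variable (g R H) in
/-- **THE MEMBER FACTS the printed derivation of (3.47) uses** (p. 398: *"the global inequalities (3.47) are consequences of the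
local ones (3.42) and Lemma 2.1"*), at one member with the transported geometry `B9Thm34Ext.toB6 g R H`: L ≧ 1 with a family
bound L ≦ L₀ (one lattice constant L for the paper), η > 0, [4] Lemma 2.1 (2.60) at the exponent α and (2.61) at 1 − α for the rate
δ of the sum's majorants, and the located size condition 4·log L ≦ αδRM of `B9Ineq347AllEntries.size_condition_compact` (of the kind
(2.59) of [4], *"RM sufficiently large"*).  A hypothesis schema («for M ≧ M_g»); nothing asserted.
[cite: Balaban1985BackgroundPropagators, p.398 remark after (3.47); Balaban1984PropagatorsII, Lemma 2.1 (2.59)–(2.61) pp.233–234] -/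
structure Facts347 (d : ℕ) (δ α L₀ : ℝ) : Prop where
  one_le_L : 1 ≤ g.L
  L_le : g.L ≤ L₀
  eta_pos : 0 < g.eta
  h260 : Ineq260 (toB6 g R H) δ α
  h261 : Ineq261 d (toB6 g R H) δ (1 - α)
  size : 4 * Real.log g.L ≤ α * δ * R * g.M

omit [DecidableEq g.Site] in
/-- **(3.47)_n FROM (3.42)_n for a co-read kernel family, constants explicit** (p. 398: *"It is easy to see that the global
inequalities (3.47) are consequences of the local ones (3.42) and Lemma 2.1"*): if the model operator T has the (3.42)_n two-space
majorant C·[(L^jη)², L^jη, L^jη, 1]_n·e^{−δd(y,y′)} (`B9SectCDiffDict.maj342 g n C δ`), the weighted quantity glob_n of K is co-read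
by T (`GlobReads`) and the member facts hold (`Facts347`), then for every γ ∈ [−4, 4] and every λ:
glob_n(U, λ, γ) ≦ C·c₁(1 − α)·L₀⁴·|λ|_{(γ)} — by `B9Ineq347AllEntries.glob347_of_342_weighted_rpow` (λ = Σ_{y′}Δ(y′)λ, (3.42)_n
block by block, the scale transfer of p. 398, (2.61)) and `size_condition_compact` (one constant on the compact set).
[cite: Balaban1985BackgroundPropagators, (3.47) p.398 + (3.42) p.397; Balaban1984PropagatorsII, Lemma 2.1 (2.60)–(2.61) p.234] -/
theorem glob_of_majorant {K : B9.KernelFamily g B} {n : Fin 4} {U : B.Cfg} {bu : u → g.Site} {bv : v → g.Site}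
    {ev : g.Loc → v → ℝ} {T : (v → ℝ) →ₗ[ℝ] (u → ℝ)} {d : ℕ} {C δ α L₀ : ℝ}
    (hF : Facts347 g R H d δ α L₀) (hG : GlobReads K n U bu bv ev T) (hC : 0 ≤ C)
    (hT : HasMajorantHom (g := toB6 g R H) bv bu T (maj342 g n C δ)) :
    ∀ (lam : g.Loc) (γ : ℝ), -4 ≤ γ → γ ≤ 4 →
      K.glob n U lam γ ≤ C * B6.c1 d δ (1 - α) * L₀ ^ (4 : ℝ) * g.wNorm γ lam := by
  intro lam γ hγ₁ hγ₂
  have hγ : |γ| ≤ 4 := abs_le.mpr ⟨by linarith, hγ₂⟩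
  have hL0 : 0 < g.L := lt_of_lt_of_le one_pos hF.one_le_L
  obtain ⟨hsz, hL4⟩ := size_condition_compact g.L γ _ hF.one_le_L hγ hF.size
  have hN : 0 ≤ g.wNorm γ lam := hG.wnorm_nonneg lam γ
  -- (3.42)_n block by block, scale transfer, (2.61): |(Tλ)(x)| ≤ C c₁ L^{|γ|} (L^jη)^{p+γ} |λ|_{(γ)}
  have hpt : ∀ x : u, |T (ev lam) x| ≤
      (C * B6.c1 d δ (1 - α) * g.L ^ |γ| * g.wNorm γ lam) * g.len (bu x) ^ ((![2, 1, 1, 0] : Fin 4 → ℝ) n + γ) := by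
    intro x
    have h := glob347_of_342_weighted_rpow (R := R) (H := H) bv bu d δ α C γ (g.wNorm γ lam) n hC hN hF.one_le_L
      hF.eta_pos hsz hF.h260 hF.h261 hT (ev lam) (fun x' => hG.wbound lam γ x') x
    calc |T (ev lam) x| ≤ C * B6.c1 d δ (1 - α) * g.L ^ |γ| *
          g.len (bu x) ^ ((![2, 1, 1, 0] : Fin 4 → ℝ) n + γ) * g.wNorm γ lam := h
      _ = (C * B6.c1 d δ (1 - α) * g.L ^ |γ| * g.wNorm γ lam) *
          g.len (bu x) ^ ((![2, 1, 1, 0] : Fin 4 → ℝ) n + γ) := by ring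
  -- c₁(1−α) ≥ 0: it dominates the (2.61) row sum of some y ∈ 𝔅 if 𝔅 ≠ ∅; if 𝔅 = ∅ the lattice u has no blocks to read
  have hc1 : 0 ≤ B6.c1 d δ (1 - α) := c1_nonneg d δ (1 - α)
  have hcoef : 0 ≤ C * B6.c1 d δ (1 - α) * g.L ^ |γ| * g.wNorm γ lam :=
    mul_nonneg (mul_nonneg (mul_nonneg hC hc1) (Real.rpow_nonneg hL0.le _)) hN
  have hglob := hG.obs lam γ _ hcoef hpt
  refine hglob.trans ?_
  -- L^{|γ|} ≤ L⁴ ≤ L₀⁴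
  have hLL : g.L ^ |γ| ≤ L₀ ^ (4 : ℝ) :=
    hL4.trans (Real.rpow_le_rpow hL0.le hF.L_le (by norm_num))
  have h1 : C * B6.c1 d δ (1 - α) * g.L ^ |γ| ≤ C * B6.c1 d δ (1 - α) * L₀ ^ (4 : ℝ) :=
    mul_le_mul_of_nonneg_left hLL (mul_nonneg hC hc1)
  exact mul_le_mul_of_nonneg_right h1 hN

end Glob

/-! ## §2 All blocks of Theorems 3.1 ∕ 3.3 for a co-read kernel family at one member and one U -/

section OneMember

variable {g : B9.Geometry} [Fintype g.Site] {R : ℝ} {H : Prop} {B : B9.Backgrounds}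
variable {X Y : Type}

/-- **THE TYPED CONCLUSION OF THEOREM 3.1 ∕ 3.3 FOR A KERNEL FAMILY `K` AT `U` from the four sup majorants of the model operators
that co-read it** (p. 410: *"Theorem 3.7 implies that all the inequalities (3.42)–(3.47) hold for G′"*; p. 416: *"From (3.108) it
follows that the expansion (3.107) is convergent in all norms in the inequalities (3.42)–(3.47). This implies Theorem 3.3."*).
Inputs: the four majorants of A₀ = G(U), A₁ = ∇_UG(U), A₂ = G(U)∇\*_U, A₃ = Δ_UG(U) with constants (C, δ) (the content of
`Conv342` ∕ `Conv3107`); the sup co-readings (`CoRealizes`, n06-c) and the weighted co-readings (`GlobReads`) of K by them; the member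
facts (`Facts347`); the sign facts d ≧ 0, L^jη > 0 of the geometry; constants 0 ≦ C ≦ B₀, δ₀ ≦ δ, C·c₁(1−α)·L₀⁴ ≦ B₀; and —
DISPLAYED, not proved — the Hölder block (3.43)–(3.45) (`B9.Ineq343_345 K …`) and the six L² lines (3.46) at (B₀, δ₀).  Output:
`B9.Ineq342_346_347 K B₀ δ₀ U ∧ B9.Ineq343_345 K Bβ Bε Bεβ δ₀ U` — (3.42) by `clause342_e*_of_hasMajorant(Hom)` + `clause342_mono`,
(3.47) by `glob_of_majorant`. [cite: Balaban1985BackgroundPropagators, Thm 3.1 (3.42)–(3.47) pp.397–398 + Thm 3.7 ⇒ Thm 3.1 p.410 + Thm 3.10 ⇒ Thm 3.3 p.416] -/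
theorem allIneqs_of_majorants {K : B9.KernelFamily g B} {U : B.Cfg} (blk : X → g.Site) (blkY : Y → g.Site)
    (ev : g.Loc → X → ℝ) (evY : g.Loc → Y → ℝ) {A0 A3 : Module.End ℝ (X → ℝ)} {A1 : (X → ℝ) →ₗ[ℝ] (Y → ℝ)}
    {A2 : (Y → ℝ) →ₗ[ℝ] (X → ℝ)} {d : ℕ} {C δ α L₀ B₀ δ₀ : ℝ} {Bβ Bε : ℝ → ℝ} {Bεβ : ℝ → ℝ → ℝ}
    (h0 : HasMajorant (g := toB6 g R H) blk A0 (fun (a b : g.Site) => C * g.len a ^ 2 * Real.exp (-(δ * g.dist a b))))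
    (h1 : HasMajorantHom (g := toB6 g R H) blk blkY A1 (fun (a b : g.Site) => C * g.len a * Real.exp (-(δ * g.dist a b))))
    (h2 : HasMajorantHom (g := toB6 g R H) blkY blk A2 (fun (a b : g.Site) => C * g.len a * Real.exp (-(δ * g.dist a b))))
    (h3 : HasMajorantHom (g := toB6 g R H) blk blk A3 (fun (a b : g.Site) => C * Real.exp (-(δ * g.dist a b))))
    (hco0 : CoRealizes K 0 U blk blk ev A0) (hco1 : CoRealizes K 1 U blkY blk ev A1)
    (hco2 : CoRealizes K 2 U blk blkY evY A2) (hco3 : CoRealizes K 3 U blk blk ev A3)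
    (hgl0 : GlobReads K 0 U blk blk ev A0) (hgl1 : GlobReads K 1 U blkY blk ev A1)
    (hgl2 : GlobReads K 2 U blk blkY evY A2) (hgl3 : GlobReads K 3 U blk blk ev A3)
    (hF : Facts347 g R H d δ α L₀) (hdist : ∀ a b : g.Site, 0 ≤ g.dist a b) (hlen : ∀ y : g.Site, 0 < g.len y)
    (hC : 0 ≤ C) (hCB : C ≤ B₀) (hδ : δ₀ ≤ δ) (hCg : C * B6.c1 d δ (1 - α) * L₀ ^ (4 : ℝ) ≤ B₀)
    (h343 : B9.Ineq343_345 K Bβ Bε Bεβ δ₀ U)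
    (h346 : ∀ (n : Fin 6) (lam : g.Loc) (h : g.Cut) (y y' : g.Site), g.cutIn h y → g.suppIn lam y' →
      K.l2 n U lam h ≤ B₀ * B9.pref6 (g.len y) n * g.cutSup h * Real.exp (-(δ₀ * g.dist y y')) * g.l2Norm lam) :
    B9.Ineq342_346_347 K B₀ δ₀ U ∧ B9.Ineq343_345 K Bβ Bε Bεβ δ₀ U := by
  have hlen0 : ∀ y : g.Site, 0 ≤ g.len y := fun y => (hlen y).le
  -- (3.42): the four clauses at (C, δ), merged to (B₀, δ₀)
  have h342C : ∀ n : Fin 4, Clause342 K n C δ U :=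
    clause342_all (clause342_e0_of_hasMajorant hco0 h0 hC hlen0) (clause342_e1_of_hasMajorantHom hco1 h1 hC hlen0)
      (clause342_e2_of_hasMajorantHom hco2 h2 hC hlen0) (clause342_e3_of_hasMajorantHom hco3 h3 hC hlen0)
  have h342 : ∀ n : Fin 4, Clause342 K n B₀ δ₀ U := fun n =>
    clause342_mono (h342C n) hC hCB hδ hdist hlen0 hco0.norm_nonneg
  -- (3.47): the four weighted lines from the same majorants
  have hm0 : HasMajorantHom (g := toB6 g R H) blk blk A0 (maj342 g 0 C δ) := by
    rw [maj342_zero]; exact (hasMajorantHom_iff (g := toB6 g R H) blk A0 _).mpr h0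
  have hm1 : HasMajorantHom (g := toB6 g R H) blk blkY A1 (maj342 g 1 C δ) := by rw [maj342_one]; exact h1
  have hm2 : HasMajorantHom (g := toB6 g R H) blkY blk A2 (maj342 g 2 C δ) := by rw [maj342_two]; exact h2
  have hm3 : HasMajorantHom (g := toB6 g R H) blk blk A3 (maj342 g 3 C δ) := by rw [maj342_three]; exact h3
  have h347 : ∀ (n : Fin 4) (lam : g.Loc) (γ : ℝ), -4 ≤ γ → γ ≤ 4 → K.glob n U lam γ ≤ B₀ * g.wNorm γ lam := by
    intro n lam γ hγ₁ hγ₂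
    have hw : ∀ (hg : 0 ≤ g.wNorm γ lam), K.glob n U lam γ ≤ C * B6.c1 d δ (1 - α) * L₀ ^ (4 : ℝ) * g.wNorm γ lam →
        K.glob n U lam γ ≤ B₀ * g.wNorm γ lam := fun hg h =>
      h.trans (mul_le_mul_of_nonneg_right hCg hg)
    fin_cases n
    · exact hw (hgl0.wnorm_nonneg lam γ) (glob_of_majorant hF hgl0 hC hm0 lam γ hγ₁ hγ₂)
    · exact hw (hgl1.wnorm_nonneg lam γ) (glob_of_majorant hF hgl1 hC hm1 lam γ hγ₁ hγ₂)
    · exact hw (hgl2.wnorm_nonneg lam γ) (glob_of_majorant hF hgl2 hC hm2 lam γ hγ₁ hγ₂)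
    · exact hw (hgl3.wnorm_nonneg lam γ) (glob_of_majorant hF hgl3 hC hm3 lam γ hγ₁ hγ₂)
  exact ⟨ineq342_346_347_of_clauses h342 h346 h347, h343⟩

end OneMember

/-! ## §3 The all-blocks pins of the two expansion data; strengthening a leaf's convergence predicate -/

section Pins

variable {g : B9.Geometry} [Fintype g.Site] [DecidableEq g.Site] {B : B9.Backgrounds} {X Y ι A : Type}

/-- **THE ALL-BLOCKS CONVERGENCE PREDICATE FOR THE SUM (3.90) G′(U)** (Theorem 3.7: *"convergent in all norms appearing in the
inequalities (3.42)–(3.47)"*): n06-c's four sup majorants `Conv342 𝔬 R H C δ U` AND the typed conclusion of Theorem 3.1 at U for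
the kernel family K READ FROM the sum (`B9.Ineq342_346_347 K B₀ δ₀ U ∧ B9.Ineq343_345 K Bβ Bε Bεβ δ₀ U`) — the shape a proviso-free
consumer can project. [cite: Balaban1985BackgroundPropagators, Thm 3.7 p.409 + Thm 3.1 (3.42)–(3.47) pp.397–398] -/
def ConvAll342 (𝔬 : Ops g B X Y ι) (R : ℝ) (H : Prop) (C δ : ℝ) (K : B9.KernelFamily g B) (B₀ δ₀ : ℝ) (Bβ Bε : ℝ → ℝ)
    (Bεβ : ℝ → ℝ → ℝ) (U : B.Cfg) : Prop :=
  Conv342 𝔬 R H C δ U ∧ (B9.Ineq342_346_347 K B₀ δ₀ U ∧ B9.Ineq343_345 K Bβ Bε Bεβ δ₀ U)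

/-- **THE ALL-BLOCKS CONVERGENCE PREDICATE FOR THE SUM (3.107) G(U)** (Theorem 3.10: *"convergent in all norms in the inequalities
(3.42)–(3.47)"*): `Conv3107 𝔬 R H C δ U` AND the typed conclusion of Theorem 3.3 at U for the kernel family K read from the sum.
[cite: Balaban1985BackgroundPropagators, Thm 3.10 p.416 + Thm 3.3 p.399] -/
def ConvAll3107 (𝔬 : Ops310 g B X Y ι A) (R : ℝ) (H : Prop) (C δ : ℝ) (K : B9.KernelFamily g B) (B₀ δ₀ : ℝ)
    (Bβ Bε : ℝ → ℝ) (Bεβ : ℝ → ℝ → ℝ) (U : B.Cfg) : Prop :=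
  Conv3107 𝔬 R H C δ U ∧ (B9.Ineq342_346_347 K B₀ δ₀ U ∧ B9.Ineq343_345 K Bβ Bε Bεβ δ₀ U)

/-- **The expansion data of Theorem 3.7 ∕ Corollary 3.8 with the ALL-BLOCKS predicate pinned**: n06-c's `E37OfOps 𝔴 𝔬 R H C δ`
with `Converges U := ConvAll342 …` (the walk readings of `𝔴` — e.g. `B9Cor38Whole.W38OfOps` — untouched).
[cite: Balaban1985BackgroundPropagators, Thm 3.7 (3.90) p.409 + Cor. 3.8 p.410] -/
def E37AllOfOps (𝔴 : B9.RWExpansion g B) (𝔬 : Ops g B X Y ι) (R : ℝ) (H : Prop) (C δ : ℝ) (K : B9.KernelFamily g B)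
    (B₀ δ₀ : ℝ) (Bβ Bε : ℝ → ℝ) (Bεβ : ℝ → ℝ → ℝ) : B9.RWExpansion g B :=
  { 𝔴 with Converges := fun U => ConvAll342 𝔬 R H C δ K B₀ δ₀ Bβ Bε Bεβ U }

omit [DecidableEq g.Site] in
/-- The convergence predicate of `E37AllOfOps` IS `ConvAll342` (by `Iff.rfl`). [cite: Balaban1985BackgroundPropagators, Thm 3.7 p.409] -/
theorem converges_E37AllOfOps (𝔴 : B9.RWExpansion g B) (𝔬 : Ops g B X Y ι) (R : ℝ) (H : Prop) (C δ : ℝ)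
    (K : B9.KernelFamily g B) (B₀ δ₀ : ℝ) (Bβ Bε : ℝ → ℝ) (Bεβ : ℝ → ℝ → ℝ) (U : B.Cfg) :
    (E37AllOfOps 𝔴 𝔬 R H C δ K B₀ δ₀ Bβ Bε Bεβ).Converges U ↔ ConvAll342 𝔬 R H C δ K B₀ δ₀ Bβ Bε Bεβ U :=
  Iff.rfl

omit [DecidableEq g.Site] in
/-- `E37AllOfOps` IS `E37OfOps` with its convergence predicate replaced (by `rfl`): the Corollary 3.8 readings are shared.
[cite: Balaban1985BackgroundPropagators, Cor. 3.8 (3.94) p.410] -/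
theorem E37AllOfOps_eq (𝔴 : B9.RWExpansion g B) (𝔬 : Ops g B X Y ι) (R : ℝ) (H : Prop) (C δ : ℝ)
    (K : B9.KernelFamily g B) (B₀ δ₀ : ℝ) (Bβ Bε : ℝ → ℝ) (Bεβ : ℝ → ℝ → ℝ) :
    E37AllOfOps 𝔴 𝔬 R H C δ K B₀ δ₀ Bβ Bε Bεβ =
      { E37OfOps 𝔴 𝔬 R H C δ with Converges := fun U => ConvAll342 𝔬 R H C δ K B₀ δ₀ Bβ Bε Bεβ U } :=
  rfl

end Pins

section Leaves

variable {I : Type} {c35 : ℝ} {geo : I → B9.Geometry} {bg : I → B9.Backgrounds}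

/-- **Strengthening the convergence predicate of a Theorem-3.7 leaf under provisos** (bookkeeping on the typed sentence): if the
leaf holds at `E` and, for M ≧ M′, 0 < α₀, Mα₀ ≦ a′ and U satisfying (3.35), `(E i).Converges U` implies `(E′ i).Converges U`, then
the leaf holds at `E′` (M₂ ↦ max(M₂, M′), a₀ ↦ min(a₀, a′)). [cite: Balaban1985BackgroundPropagators, Thm 3.7 p.409 (the typed sentence; bookkeeping)] -/
theorem thm37Printed_strengthen {E E' : ∀ i, B9.RWExpansion (geo i) (bg i)} (h : B9.Thm37Printed c35 geo bg E)
    (M' a' : ℝ) (ha' : 0 < a')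
    (himp : ∀ i, M' ≤ (geo i).M → ∀ α₀ : ℝ, 0 < α₀ → (geo i).M * α₀ ≤ a' →
      ∀ U : (bg i).Cfg, (bg i).Reg335 c35 α₀ U → (E i).Converges U → (E' i).Converges U) :
    B9.Thm37Printed c35 geo bg E' := by
  obtain ⟨M₂, a₀, hM₂, ha₀, hE⟩ := h
  refine ⟨max M₂ M', min a₀ a', lt_max_of_lt_left hM₂, lt_min ha₀ ha', fun i hM α₀ hα₀ hMa U hU => ?_⟩
  exact himp i (le_trans (le_max_right _ _) hM) α₀ hα₀ (hMa.trans (min_le_right _ _)) U hU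
    (hE i (le_trans (le_max_left _ _) hM) α₀ hα₀ (hMa.trans (min_le_left _ _)) U hU)

/-- The same for the Corollary-3.8 leaf: it does not read `Converges`, so `E37AllOfOps` and `E37OfOps` carry it together (by
`Iff.rfl`, as n06-c's `cor38Printed_E37OfOps_iff`). [cite: Balaban1985BackgroundPropagators, Cor. 3.8 (3.93)–(3.94) p.410] -/
theorem cor38Printed_E37AllOfOps_iff {X Y ι : I → Type} [∀ i, Fintype (geo i).Site]
    (𝔴 : ∀ i, B9.RWExpansion (geo i) (bg i)) (𝔬 : ∀ i, Ops (geo i) (bg i) (X i) (Y i) (ι i)) (R : I → ℝ) (H : I → Prop)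
    (C δ : ℝ) (K : ∀ i, B9.KernelFamily (geo i) (bg i)) (B₀ δ₀ : ℝ) (Bβ Bε : ℝ → ℝ) (Bεβ : ℝ → ℝ → ℝ) :
    B9.Cor38Printed c35 geo bg (fun i => E37AllOfOps (𝔴 i) (𝔬 i) (R i) (H i) C δ (K i) B₀ δ₀ Bβ Bε Bεβ) ↔
      B9.Cor38Printed c35 geo bg 𝔴 :=
  Iff.rfl

/-- **Strengthening the convergence predicate of a Theorem-3.10 leaf at `W310OfOps` under provisos**: the walk readings are shared
by all pins (`W310OfOps_congr_conv`), so a leaf at `W310OfOps … Conv` and an implication `Conv i U → Conv′ i U` under provisos give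
the leaf at `W310OfOps … Conv′`. [cite: Balaban1985BackgroundPropagators, Thm 3.10 p.416 (the typed sentence; bookkeeping)] -/
theorem thm310Printed_W310OfOps_strengthen {X Y ι A : I → Type} [∀ i, Fintype (geo i).Site] [∀ i, DecidableEq (geo i).Site]
    {𝔬 : ∀ i, Ops310 (geo i) (bg i) (X i) (Y i) (ι i) (A i)} {rd : ∀ i, WalkReading310 (geo i) (bg i) (X i) (ι i) (A i)}
    {Conv Conv' : ∀ i, (bg i).Cfg → Prop} (h : B9.Thm310Printed c35 geo bg (fun i => W310OfOps (𝔬 i) (rd i) (Conv i)))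
    (M' a' : ℝ) (ha' : 0 < a')
    (himp : ∀ i, M' ≤ (geo i).M → ∀ α₀ : ℝ, 0 < α₀ → (geo i).M * α₀ ≤ a' →
      ∀ U : (bg i).Cfg, (bg i).Reg335 c35 α₀ U → Conv i U → Conv' i U) :
    B9.Thm310Printed c35 geo bg (fun i => W310OfOps (𝔬 i) (rd i) (Conv' i)) := by
  obtain ⟨M₂, a₀, δ₁, C₁, c₁, hM₂, ha₀, hδ₁, hC₁, hc₁, hE⟩ := h
  refine ⟨max M₂ M', min a₀ a', δ₁, C₁, c₁, lt_max_of_lt_left hM₂, lt_min ha₀ ha', hδ₁, hC₁, hc₁,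
    fun i hM α₀ hα₀ hMa U hU => ?_⟩
  obtain ⟨hconv, hrest⟩ := hE i (le_trans (le_max_left _ _) hM) α₀ hα₀ (hMa.trans (min_le_left _ _)) U hU
  exact ⟨himp i (le_trans (le_max_right _ _) hM) α₀ hα₀ (hMa.trans (min_le_right _ _)) U hU hconv, hrest⟩

end Leaves

/-! ## §4 The leaves at the all-blocks pins -/

section AllPins

variable {I : Type} {c35 : ℝ} {geo : I → B9.Geometry} {bg : I → B9.Backgrounds}
variable [∀ i, Fintype (geo i).Site] [∀ i, DecidableEq (geo i).Site]

/-- ★ **THEOREM 3.10 AT THE ALL-BLOCKS PIN** — p. 416: *"From (3.108) it follows that the expansion (3.107) is convergent in all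
norms in the inequalities (3.42)–(3.47). This implies Theorem 3.3."*  From the leaf at the sup-block pin (this seat's
`B9Thm310Whole.thm310Printed_of_local3107`: the four (3.42) majorants of the sum G(U) under the printed provisos), the sup and
weighted CO-READINGS of the kernel family `K i` (at the record: `(ops x).GA`) by the four model operators G(U), ∇_UG(U), G(U)∇\*_U,
Δ_UG(U) of `𝔬 i`, the member facts of [4] Lemma 2.1 for M ≧ M_g (`Facts347`), the sign facts of the geometry, the constants
0 ≦ C ≦ B₀, δ₀ ≦ δ, C·c₁(1−α)·L₀⁴ ≦ B₀, and — DISPLAYED under the provisos M ≧ M_r, 0 < α₀, Mα₀ ≦ a_r, (3.35), NOT proved — the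
Hölder block (3.43)–(3.45) and the six L² lines (3.46) for `K i`: the leaf `B9.Thm310Printed c35 geo bg (fun i => W310OfOps (𝔬 i)
(rd i) (ConvAll3107 (𝔬 i) (R i) (H i) C δ (K i) B₀ δ₀ Bβ Bε Bεβ))`, whose `Converges U` ENTAILS `B9.Ineq342_346_347 (K i) B₀ δ₀ U ∧
B9.Ineq343_345 (K i) Bβ Bε Bεβ δ₀ U` ((3.42) and (3.47) PROVED inside by `allIneqs_of_majorants`).  Nothing of print asserted; NOT a
node discharge. [cite: Balaban1985BackgroundPropagators, Thm 3.10 (3.107)–(3.108) pp.415–416 + Thm 3.3 p.399 + (3.42)–(3.47) pp.397–398; Balaban1984PropagatorsII, Lemma 2.1 p.234] -/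
theorem thm310Printed_allPin {X Y ι A : I → Type} {𝔬 : ∀ i, Ops310 (geo i) (bg i) (X i) (Y i) (ι i) (A i)}
    {rd : ∀ i, WalkReading310 (geo i) (bg i) (X i) (ι i) (A i)} {R : I → ℝ} {H : I → Prop} {C δ : ℝ}
    (K : ∀ i, B9.KernelFamily (geo i) (bg i)) (ev : ∀ i, (geo i).Loc → X i → ℝ) (evY : ∀ i, (geo i).Loc → Y i → ℝ)
    {d : ℕ} {α L₀ B₀ δ₀ Mg Mr ar : ℝ} {Bβ Bε : ℝ → ℝ} {Bεβ : ℝ → ℝ → ℝ}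
    (h310 : B9.Thm310Printed c35 geo bg (fun i => W310OfOps (𝔬 i) (rd i) (Conv3107 (𝔬 i) (R i) (H i) C δ)))
    (hco0 : ∀ i U, CoRealizes (K i) 0 U (𝔬 i).blk (𝔬 i).blk (ev i) ((𝔬 i).G U))
    (hco1 : ∀ i U, CoRealizes (K i) 1 U (𝔬 i).blkY (𝔬 i).blk (ev i) ((𝔬 i).D U ∘ₗ (𝔬 i).G U))
    (hco2 : ∀ i U, CoRealizes (K i) 2 U (𝔬 i).blk (𝔬 i).blkY (evY i) ((𝔬 i).G U ∘ₗ (𝔬 i).Dstar U))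
    (hco3 : ∀ i U, CoRealizes (K i) 3 U (𝔬 i).blk (𝔬 i).blk (ev i) ((𝔬 i).Lap U ∘ₗ (𝔬 i).G U))
    (hgl0 : ∀ i U, GlobReads (K i) 0 U (𝔬 i).blk (𝔬 i).blk (ev i) ((𝔬 i).G U))
    (hgl1 : ∀ i U, GlobReads (K i) 1 U (𝔬 i).blkY (𝔬 i).blk (ev i) ((𝔬 i).D U ∘ₗ (𝔬 i).G U))
    (hgl2 : ∀ i U, GlobReads (K i) 2 U (𝔬 i).blk (𝔬 i).blkY (evY i) ((𝔬 i).G U ∘ₗ (𝔬 i).Dstar U))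
    (hgl3 : ∀ i U, GlobReads (K i) 3 U (𝔬 i).blk (𝔬 i).blk (ev i) ((𝔬 i).Lap U ∘ₗ (𝔬 i).G U))
    (hfacts : ∀ i, Mg ≤ (geo i).M → Facts347 (geo i) (R i) (H i) d δ α L₀)
    (hdist : ∀ i (a b : (geo i).Site), 0 ≤ (geo i).dist a b) (hlen : ∀ i (y : (geo i).Site), 0 < (geo i).len y)
    (hC : 0 ≤ C) (hCB : C ≤ B₀) (hδ₀ : δ₀ ≤ δ) (hCg : C * B6.c1 d δ (1 - α) * L₀ ^ (4 : ℝ) ≤ B₀) (har : 0 < ar)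
    (hrest : ∀ i, Mr ≤ (geo i).M → ∀ α₀ : ℝ, 0 < α₀ → (geo i).M * α₀ ≤ ar → ∀ U : (bg i).Cfg, (bg i).Reg335 c35 α₀ U →
      B9.Ineq343_345 (K i) Bβ Bε Bεβ δ₀ U ∧
        ∀ (n : Fin 6) (lam : (geo i).Loc) (h : (geo i).Cut) (y y' : (geo i).Site), (geo i).cutIn h y → (geo i).suppIn lam y' →
          (K i).l2 n U lam h ≤ B₀ * B9.pref6 ((geo i).len y) n * (geo i).cutSup h * Real.exp (-(δ₀ * (geo i).dist y y')) *
            (geo i).l2Norm lam) :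
    B9.Thm310Printed c35 geo bg
      (fun i => W310OfOps (𝔬 i) (rd i) (ConvAll3107 (𝔬 i) (R i) (H i) C δ (K i) B₀ δ₀ Bβ Bε Bεβ)) := by
  refine thm310Printed_W310OfOps_strengthen h310 (max Mg Mr) ar har fun i hM α₀ hα₀ hMa U hU hconv => ?_
  have hMg : Mg ≤ (geo i).M := le_trans (le_max_left _ _) hM
  have hMr : Mr ≤ (geo i).M := le_trans (le_max_right _ _) hM
  obtain ⟨h343, h346⟩ := hrest i hMr α₀ hα₀ hMa U hU
  obtain ⟨h0, h1, h2, h3⟩ := hconv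
  exact ⟨⟨h0, h1, h2, h3⟩, allIneqs_of_majorants (𝔬 i).blk (𝔬 i).blkY (ev i) (evY i) h0 h1 h2 h3 (hco0 i U) (hco1 i U)
    (hco2 i U) (hco3 i U) (hgl0 i U) (hgl1 i U) (hgl2 i U) (hgl3 i U) (hfacts i hMg) (hdist i) (hlen i) hC hCB hδ₀ hCg
    h343 h346⟩

omit [∀ i, DecidableEq (geo i).Site] in
/-- ★ **THEOREM 3.7 AT THE ALL-BLOCKS PIN** — p. 409: *"The expansion is convergent in all norms appearing in the inequalities
(3.42)–(3.47)"*; p. 410: *"Theorem 3.7 implies that all the inequalities (3.42)–(3.47) hold for G′"*.  From n06-c's leaf at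
`E37OfOps` (`B9Thm37Whole.thm37Printed_of_local342`: the four (3.42) majorants `Conv342` of the sum G′(U) under the printed
provisos), the sup and weighted co-readings of the kernel family `K i` (at the record: `(ops x).Gp`) by G′(U), ∇_UG′(U), G′(U)∇\*_U,
Δ_UG′(U) of `𝔬 i`, the member facts for M ≧ M_g, the sign facts, the constants, and — DISPLAYED under provisos, NOT proved — the
Hölder block (3.43)–(3.45) and the six L² lines (3.46) for `K i`: the leaf `B9.Thm37Printed c35 geo bg (fun i => E37AllOfOps (𝔴 i)
(𝔬 i) (R i) (H i) C δ (K i) B₀ δ₀ Bβ Bε Bεβ)`.  Nothing of print asserted; NOT a node discharge.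
[cite: Balaban1985BackgroundPropagators, Thm 3.7 p.409 + Thm 3.7 ⇒ Thm 3.1 p.410 + (3.42)–(3.47) pp.397–398; Balaban1984PropagatorsII, Lemma 2.1 p.234] -/
theorem thm37Printed_allPin {X Y ι : I → Type} {𝔴 : ∀ i, B9.RWExpansion (geo i) (bg i)}
    {𝔬 : ∀ i, Ops (geo i) (bg i) (X i) (Y i) (ι i)} {R : I → ℝ} {H : I → Prop} {C δ : ℝ}
    (K : ∀ i, B9.KernelFamily (geo i) (bg i)) (ev : ∀ i, (geo i).Loc → X i → ℝ) (evY : ∀ i, (geo i).Loc → Y i → ℝ)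
    {d : ℕ} {α L₀ B₀ δ₀ Mg Mr ar : ℝ} {Bβ Bε : ℝ → ℝ} {Bεβ : ℝ → ℝ → ℝ}
    (h37 : B9.Thm37Printed c35 geo bg (fun i => E37OfOps (𝔴 i) (𝔬 i) (R i) (H i) C δ))
    (hco0 : ∀ i U, CoRealizes (K i) 0 U (𝔬 i).blk (𝔬 i).blk (ev i) ((𝔬 i).Gp U))
    (hco1 : ∀ i U, CoRealizes (K i) 1 U (𝔬 i).blkY (𝔬 i).blk (ev i) ((𝔬 i).D U ∘ₗ (𝔬 i).Gp U))
    (hco2 : ∀ i U, CoRealizes (K i) 2 U (𝔬 i).blk (𝔬 i).blkY (evY i) ((𝔬 i).Gp U ∘ₗ (𝔬 i).Dstar U))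
    (hco3 : ∀ i U, CoRealizes (K i) 3 U (𝔬 i).blk (𝔬 i).blk (ev i) ((𝔬 i).Lap U ∘ₗ (𝔬 i).Gp U))
    (hgl0 : ∀ i U, GlobReads (K i) 0 U (𝔬 i).blk (𝔬 i).blk (ev i) ((𝔬 i).Gp U))
    (hgl1 : ∀ i U, GlobReads (K i) 1 U (𝔬 i).blkY (𝔬 i).blk (ev i) ((𝔬 i).D U ∘ₗ (𝔬 i).Gp U))
    (hgl2 : ∀ i U, GlobReads (K i) 2 U (𝔬 i).blk (𝔬 i).blkY (evY i) ((𝔬 i).Gp U ∘ₗ (𝔬 i).Dstar U))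
    (hgl3 : ∀ i U, GlobReads (K i) 3 U (𝔬 i).blk (𝔬 i).blk (ev i) ((𝔬 i).Lap U ∘ₗ (𝔬 i).Gp U))
    (hfacts : ∀ i, Mg ≤ (geo i).M → Facts347 (geo i) (R i) (H i) d δ α L₀)
    (hdist : ∀ i (a b : (geo i).Site), 0 ≤ (geo i).dist a b) (hlen : ∀ i (y : (geo i).Site), 0 < (geo i).len y)
    (hC : 0 ≤ C) (hCB : C ≤ B₀) (hδ₀ : δ₀ ≤ δ) (hCg : C * B6.c1 d δ (1 - α) * L₀ ^ (4 : ℝ) ≤ B₀) (har : 0 < ar)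
    (hrest : ∀ i, Mr ≤ (geo i).M → ∀ α₀ : ℝ, 0 < α₀ → (geo i).M * α₀ ≤ ar → ∀ U : (bg i).Cfg, (bg i).Reg335 c35 α₀ U →
      B9.Ineq343_345 (K i) Bβ Bε Bεβ δ₀ U ∧
        ∀ (n : Fin 6) (lam : (geo i).Loc) (h : (geo i).Cut) (y y' : (geo i).Site), (geo i).cutIn h y → (geo i).suppIn lam y' →
          (K i).l2 n U lam h ≤ B₀ * B9.pref6 ((geo i).len y) n * (geo i).cutSup h * Real.exp (-(δ₀ * (geo i).dist y y')) *
            (geo i).l2Norm lam) :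
    B9.Thm37Printed c35 geo bg (fun i => E37AllOfOps (𝔴 i) (𝔬 i) (R i) (H i) C δ (K i) B₀ δ₀ Bβ Bε Bεβ) := by
  refine thm37Printed_strengthen h37 (max Mg Mr) ar har fun i hM α₀ hα₀ hMa U hU hconv => ?_
  have hMg : Mg ≤ (geo i).M := le_trans (le_max_left _ _) hM
  have hMr : Mr ≤ (geo i).M := le_trans (le_max_right _ _) hM
  obtain ⟨h343, h346⟩ := hrest i hMr α₀ hα₀ hMa U hU
  obtain ⟨h0, h1, h2, h3⟩ := hconv
  exact ⟨⟨h0, h1, h2, h3⟩, allIneqs_of_majorants (𝔬 i).blk (𝔬 i).blkY (ev i) (evY i) h0 h1 h2 h3 (hco0 i U) (hco1 i U)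
    (hco2 i U) (hco3 i U) (hgl0 i U) (hgl1 i U) (hgl2 i U) (hgl3 i U) (hfacts i hMg) (hdist i) (hlen i) hC hCB hδ₀ hCg
    h343 h346⟩

/-! ## §5 The summation leaf at the all-blocks pins -/

omit [∀ i, Fintype (geo i).Site] [∀ i, DecidableEq (geo i).Site] in
/-- **The summation leaf from two implications** (bookkeeping on the typed sentence): if at every member and configuration
`(E7 i).Converges U` entails Theorem 3.1's typed inequalities for `Gp i` and `(E10 i).Converges U` entails Theorem 3.3's for `GA i`,
with one set of positive constants, then `B9.RWSumsYieldIneqs geo bg E7 E10 Gp GA`. [cite: Balaban1985BackgroundPropagators, Thm 3.7 ⇒ Thm 3.1 p.410 + Thm 3.10 ⇒ Thm 3.3 p.416 (bookkeeping)] -/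
theorem rwSumsYieldIneqs_of_converges {E7 E10 : ∀ i, B9.RWExpansion (geo i) (bg i)}
    {Gp GA : ∀ i, B9.KernelFamily (geo i) (bg i)} {B₀ δ₀ : ℝ} {Bβ Bε : ℝ → ℝ} {Bεβ : ℝ → ℝ → ℝ} (hB₀ : 0 < B₀)
    (hδ₀ : 0 < δ₀)
    (h7 : ∀ i (U : (bg i).Cfg), (E7 i).Converges U → B9.Ineq342_346_347 (Gp i) B₀ δ₀ U ∧ B9.Ineq343_345 (Gp i) Bβ Bε Bεβ δ₀ U)
    (h10 : ∀ i (U : (bg i).Cfg), (E10 i).Converges U →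
      B9.Ineq342_346_347 (GA i) B₀ δ₀ U ∧ B9.Ineq343_345 (GA i) Bβ Bε Bεβ δ₀ U) :
    B9.RWSumsYieldIneqs geo bg E7 E10 Gp GA :=
  ⟨B₀, δ₀, Bβ, Bε, Bεβ, hB₀, hδ₀, fun i U => ⟨h7 i U, h10 i U⟩⟩

omit [∀ i, DecidableEq (geo i).Site] in
/-- ★ **THE SUMMATION LEAF `B9.RWSumsYieldIneqs` AT THE ALL-BLOCKS PINS — two projections.**  With Theorem 3.7's datum pinned at
`E37AllOfOps (𝔴 i) (𝔬₇ i) … (Gp i) B₀ δ₀ Bβ Bε Bεβ` and Theorem 3.10's at `W310OfOps (𝔬 i) (rd i) (ConvAll3107 (𝔬 i) … (GA i) B₀ δ₀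
Bβ Bε Bεβ)` (the kernel families read from the sums being the leaf's own `Gp i`, `GA i`), p. 410 *"Theorem 3.7 implies that all
the inequalities (3.42)–(3.47) hold for G′"* and p. 416 *"This implies Theorem 3.3"* hold BY CONSTRUCTION of the pins: no
proviso-free residual remains in the leaf; the content sits in `thm37Printed_allPin` ∕ `thm310Printed_allPin` under the printed
provisos.  Kernel-checked bookkeeping, NOT a node discharge. [cite: Balaban1985BackgroundPropagators, Thm 3.7 proof p.409–410 + Thm 3.10 proof p.416] -/
theorem rwSumsYieldIneqs_allPins {X₇ Y₇ ι₇ X Y ι A : I → Type} (𝔴 : ∀ i, B9.RWExpansion (geo i) (bg i))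
    (𝔬₇ : ∀ i, Ops (geo i) (bg i) (X₇ i) (Y₇ i) (ι₇ i)) (R₇ : I → ℝ) (H₇ : I → Prop) (C₇ δ₇ : ℝ)
    (𝔬 : ∀ i, Ops310 (geo i) (bg i) (X i) (Y i) (ι i) (A i)) (rd : ∀ i, WalkReading310 (geo i) (bg i) (X i) (ι i) (A i))
    (R : I → ℝ) (H : I → Prop) (C δ : ℝ) (Gp GA : ∀ i, B9.KernelFamily (geo i) (bg i)) {B₀ δ₀ : ℝ} (Bβ Bε : ℝ → ℝ)
    (Bεβ : ℝ → ℝ → ℝ) (hB₀ : 0 < B₀) (hδ₀ : 0 < δ₀) :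
    B9.RWSumsYieldIneqs geo bg (fun i => E37AllOfOps (𝔴 i) (𝔬₇ i) (R₇ i) (H₇ i) C₇ δ₇ (Gp i) B₀ δ₀ Bβ Bε Bεβ)
      (fun i => W310OfOps (𝔬 i) (rd i) (ConvAll3107 (𝔬 i) (R i) (H i) C δ (GA i) B₀ δ₀ Bβ Bε Bεβ)) Gp GA :=
  rwSumsYieldIneqs_of_converges hB₀ hδ₀ (fun _ _ h => h.2) (fun _ _ h => h.2)

omit [∀ i, DecidableEq (geo i).Site] in
/-- **p. 416: «Thus we have completed the proofs of all theorems formulated until now» — Theorem 3.3 as typed from the two leaves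
at the all-blocks pins and the summation leaf** (`B9.thm33_of_thm37_310`, the cell's bookkeeping).
[cite: Balaban1985BackgroundPropagators, Thm 3.10 ⇒ Thm 3.3 p.416] -/
theorem thm33Printed_allPins {X₇ Y₇ ι₇ X Y ι A : I → Type} (𝔴 : ∀ i, B9.RWExpansion (geo i) (bg i))
    (𝔬₇ : ∀ i, Ops (geo i) (bg i) (X₇ i) (Y₇ i) (ι₇ i)) (R₇ : I → ℝ) (H₇ : I → Prop) (C₇ δ₇ : ℝ)
    (𝔬 : ∀ i, Ops310 (geo i) (bg i) (X i) (Y i) (ι i) (A i)) (rd : ∀ i, WalkReading310 (geo i) (bg i) (X i) (ι i) (A i))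
    (R : I → ℝ) (H : I → Prop) (C δ : ℝ) (Gp GA : ∀ i, B9.KernelFamily (geo i) (bg i)) {B₀ δ₀ : ℝ} (Bβ Bε : ℝ → ℝ)
    (Bεβ : ℝ → ℝ → ℝ) (hB₀ : 0 < B₀) (hδ₀ : 0 < δ₀)
    (h37 : B9.Thm37Printed c35 geo bg (fun i => E37AllOfOps (𝔴 i) (𝔬₇ i) (R₇ i) (H₇ i) C₇ δ₇ (Gp i) B₀ δ₀ Bβ Bε Bεβ))
    (h310 : B9.Thm310Printed c35 geo bg
      (fun i => W310OfOps (𝔬 i) (rd i) (ConvAll3107 (𝔬 i) (R i) (H i) C δ (GA i) B₀ δ₀ Bβ Bε Bεβ))) :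
    B9.Thm33Printed c35 geo bg Gp GA :=
  B9.thm33_of_thm37_310 c35 geo bg _ _ Gp GA h37 h310
    (rwSumsYieldIneqs_allPins 𝔴 𝔬₇ R₇ H₇ C₇ δ₇ 𝔬 rd R H C δ Gp GA Bβ Bε Bεβ hB₀ hδ₀)

end AllPins

end

end Literature.MathematicalPhysics.QuantumFieldTheory.Balaban1983to89.B9RWSums343to347Whole
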